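import Literature.Probability.Percolation.FlipFourArm
import Literature.Probability.Percolation.LandedAltFourArm
import HarnessLib

/-!
# The four-arm exponent from its four published inputs, in their printed shapes (proofs only)

Topic `Literature/Probability/Percolation`; family `crit-perc`. Proof-only companion of
`ArmExponents.lean` for the named fact `Literature.Probability.Percolation.fourArm_exponent`
(S. Smirnov, W. Werner, *Critical exponents for two-dimensional percolation*, Math. Res. Lett. 8
(2001) 729–744 = arXiv `math/0109120`, Thm. 4 for `j = 4`: `b₄(r, R) = R^{-5/4 + o(1)}`), after
`ArmExponentsFourArm(.lean, Proofs)`, `ArmEventsAPrioriPoly`, `ArmSeparationFourArm(.lean, Proofs)`,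
`ArmPatternsFourArm` and `FlipFourArm` (this seat) and `AltFourArm`, `LandedAltFourArm`,
`ArmExponentsFourArmAlt` (the alternating architecture). No definition, no named fact.

The point. After colour switching (`fourArm_flip`, Nolin's Prop. 20) and Kesten's gluing
(`critFourArmProb_quasiMult_of_separation`) were proved, what separates the tree from
`fourArm_exponent_holds` is exactly four published statements, none of which is a named fact of
the tree (a proving seat may not mint them, D-0026), and this file assembles `fourArm_exponent`
from the four of them stated as hypotheses **in the shape in which they are printed**, so that
each can be supplied verbatim by whoever vendors or proves it:

* **(16)₄ — the scaling limit of the ALTERNATING four-arm probabilities** `hlim`: there is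
  `g : ℝ → ℝ` with `P_{1/2}(altFourArm (ρ r) (ρ R)) → g(R/r)` as `ρ → ∞`, for all integers
  `1 ≤ r < R` — Garban–Pete–Schramm 2013, §2.4, Lemma 2.9 ("the alternating 4-arm event … in `A`
  … [is] measurable w.r.t. the scaling limit of critical percolation in `D`, and
  `lim_{η→0} P_η[𝒜₄] = P₀[𝒜₄]`", with the uniqueness and scale invariance of the full scaling
  limit, Camia–Newman 2006), the published form of Smirnov–Werner's (16) ("`b_j(ρr, ρR)` has a
  scaling limit, which is conformally invariant, and so depends on the ratio `R/r` only") for the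
  alternating event, which is the one seen by the exploration process (SW Remark 6);
* **(9)₄ — its `SLE₆` exponent** `hexp`: `log g(n) / log n → -5/4` along the integers —
  Smirnov–Werner (9) = (12) + (13) + (15) for `j = 4` (radial/annular `SLE₆` and the exponents
  `ν(λ)` of Lawler–Schramm–Werner, Acta Math. 187 (2001), Thm. 3.1; `(4² - 1)/12 = 5/4`);
* **Sep — arm separation for `σ = BWBW`** `hAlt`: `c · P_{1/2}(altFourArm n N) ≤ P_{1/2}(sepFourArm n N)`
  for `n₀ ≤ n`, `2n ≤ N` — Nolin 2008, Thm. 11 [arXiv 0711.4948: Thm. 10] for `j = 4`,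
  alternating colours, landing areas the middle halves of the sides `0, 1, 3, 4` (Kesten 1987);
* **Land — landing for `σ = BBWW`** `hLand`: `c · P_{1/2}(adjFourArm n N) ≤ P_{1/2}(landedFourAdj n N)`
  — the same theorem for the adjacent arrangement, external landing only (the separation input
  of Nolin's colour exchange, Prop. 20 [arXiv Prop. 19]).

Contents (all proved):

* `exists_pow_le_landedAltFourArm_dyadic`, `exists_rpow_le_altFourArmProb` — **the RSW a-priori
  lower bound for the alternating event**, `c (n/N)^ζ ≤ P_{1/2}(altFourArm n N)` for `3 ≤ n ≤ N`
  (SW p. 9: "By standard RSW theory, `b_j(r, R)` is bounded from below by a power of `R/r`";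
  Nolin Prop. 14 [arXiv Prop. 13]): four dyadic RSW chains in the open `60°` cones over the sides
  `0, 1, 3, 4`, coloured open, closed, open, closed, are landed alternating arms
  (`mem_landedAltFourArm_of_pathIn`, `landedAltFourArm_subset_altFourArm`); independence across
  the disjoint cones as in `exists_pow_le_polyArmProb_sector_dyadic`.
* `altFourArmProb_scaleBounds_of_limits` — (16)₄ + (9)₄ ⇒ the two-sided scale bounds
  `K^{-5/4-ε} ≤ P(altFourArm (4σ) (Kσ)) ≤ K^{-5/4+ε}` (large `K`, then large `σ`), by the
  abstract integer-dilation calculus `PolyArmScalingLimit.*` and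
  `ArmExponentAssembly.scaleBounds_of_natLimit` run for the alternating probabilities (they are
  non-increasing in the outer radius and obey the RSW lower bound above).
* `critFourArmProb_scaleBounds_of_alt` — scale bounds for the alternating event and the bridge
  `c · π₄ ≤ P(altFourArm) ≤ π₄` give scale bounds for `π₄` (constants are absorbed by `K^{±ε}`).
* **`fourArm_exponent_of_altLimits`** — (16)₄ + (9)₄ + Sep + Land ⇒ `fourArm_exponent`: the
  bridge is `fourArm_bridge_of_landing hLand` (the flip being proved), separation for `π₄` is
  `critFourArm_separation_of_alt`, quasi-multiplicativity (SW (10)) is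
  `critFourArmProb_quasiMult_of_separation`, and the assembly along the scales `K^l` (SW p. 5) is
  `fourArm_exponent_of_scaleBounds_crit`.
* `fourArm_exponent_of_altLimits_of_nearCritical` — the same with Sep read off at `t = 1/2` from
  the near-critical alternating separation hypothesis of the `θ`-exponent programme
  (`critAltFourArm_separation_of_nearCritical`).

## References

* S. Smirnov, W. Werner, Math. Res. Lett. 8 (2001) 729–744; arXiv:math/0109120, Thm. 4 (`j = 4`),
  §4 (9), (10), (12)–(16), Remark 6, §4.2 p. 9 [SmirnovWernerMRL2001].
* C. Garban, G. Pete, O. Schramm, *Pivotal, cluster, and interface measures for critical planar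
  percolation*, J. Amer. Math. Soc. 26 (2013) 939–1024, §2.4, Lemma 2.9 (arXiv 1008.1378, §2.4
  "The limit of arm events") [GarbanPeteSchramm2013Pivotal].
* G. F. Lawler, O. Schramm, W. Werner, *Values of Brownian intersection exponents II: Plane
  exponents*, Acta Math. 187 (2001) 275–308 [LawlerSchrammWerner2001PlaneExponents].
* P. Nolin, *Near-critical percolation in two dimensions*, Electron. J. Probab. 13 (2008), Thm. 11,
  Prop. 14, §5.1 Prop. 20, Thm. 22 (arXiv 0711.4948: Thm. 10, Prop. 13, Prop. 19, Thm. 21)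
  [Nolin2008].
* H. Kesten, *Scaling relations for 2D-percolation*, Comm. Math. Phys. 109 (1987), Lemmas 4–6
  [KestenScalingCMP1987].
* F. Camia, C. M. Newman, Comm. Math. Phys. 268 (2006), Thm. 1 [CamiaNewman2006].

Tree: `altFourArm`, `altFourArmProbAt`, `altFourArmProbAt_anti`, `altFourArmProbAt_le_one`,
`altFourArmProbAt_nonneg` (`AltFourArm.lean`); `landedAltFourArm`, `landSide`, `hexSide`,
`mem_landedAltFourArm_of_pathIn`, `landedAltFourArm_subset_altFourArm` (`LandedAltFourArm.lean`);
`exists_sectorPath_of_sectorChain`, `rot_sector_injective`, `pathIn_of_rotConfig_colour`,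
`triSitePercolation_half_real_preimage_colour`, `determinedBy_preimage_colour`, `dyadicIndex_spec`
(`ArmEventsAPrioriPoly.lean`, `ArmEventsAPriori.lean`); `PolyArmScalingLimit.tendsto_log_limit_div_log`,
`ArmExponentAssembly.scaleBounds_of_natLimit`, `fourArm_exponent_of_scaleBounds_crit`
(`ArmExponentsFourArmProofs.lean`); `critFourArmProb_quasiMult_of_separation`
(`ArmSeparationFourArmProofs.lean`); `critFourArm_separation_of_alt`,
`critAltFourArm_separation_of_nearCritical`, `altFourArmProbAt_half` (`ArmPatternsFourArm.lean`);
`fourArm_bridge_of_landing` (`FlipFourArm.lean`); `sitePercolation_real_biInter_ge_prod`,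
`sitePercolation_harris'`, `sitePercolation_real_iInter_eq_prod`, `tri_rsw_half_holds`,
`real_preimage_rotConfig`, `determinedBy_preimage_rotConfig`.
-/

noncomputable section

open Filter MeasureTheory Set
open _root_.Topology

namespace Literature.Probability.Percolation

open LatticeModels

/-! ### The RSW a-priori lower bound for landed alternating arms -/

/-- The four landing sides `0, 1, 3, 4` are pairwise distinct and `< 6`. [folklore] -/
theorem landSide_lt_six (j : Fin 4) : landSide j < 6 := by
  fin_cases j <;> simp [landSide]

/-- `landSide` is injective. [folklore] -/
theorem landSide_injective : Function.Injective landSide := by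
  intro i j h
  fin_cases i <;> fin_cases j <;> simp_all [landSide]

/-- A site of the open cone `{0 < x₀, x₁ < 0, 0 < x₀ + x₁}` of graph norm `N`, rotated by `ρ^i`,
lies on side `i` of `∂Λ_N`. [folklore] -/
theorem rot_mem_hexSide_of_cone {N : ℕ} {i : ℕ} {s : Site 2} (hs : 0 < s 0 ∧ s 1 < 0 ∧ 0 < s 0 + s 1)
    (hN : triNorm s = N) : triRotIsoPow i s ∈ hexSide N i := by
  refine mem_hexSide_iff.2 ⟨s, ⟨?_, ?_, hs.2.1.le⟩, rfl⟩
  · rw [← hN, triNorm_eq_apply_zero hs.2.1.le hs.2.2.le]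
  · have := triNorm_le_iff_lin.1 hN.le
    omega

/-- **RSW lower bound along dyadic scales for landed alternating arms** (the lower half of Nolin
2008, Prop. 14 [arXiv 0711.4948: Prop. 13] for `j = 4`, `σ = BWBW`, at `p = 1/2`; Smirnov–Werner
2001, §4.2 p. 9, "By standard RSW theory, `b_j(r, R)` is bounded from below by a power of `R/r`").
There is `c₀ ∈ (0, 1/2]` (the RSW constant of `tri_rsw_half_holds` at aspect ratio `9`) with
`P_{1/2}(landedAltFourArm n (2^{m+2} n)) ≥ c₀^{4(2m+1)}` for all `n ≥ 3` and all `m`: the dyadic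
open chain of `exists_sectorPath_of_sectorChain` inside the open cone over side `0`, read in the
frames `ρ^{0}, ρ^{1}, ρ^{3}, ρ^{4}` and in the colours open, closed, open, closed, gives four arms
in four disjoint cones landing on the sides `0, 1, 3, 4` (`mem_landedAltFourArm_of_pathIn`); the
four events are equiprobable (rotation invariance, colour exchange at `p = 1/2`) and independent
(disjoint cones, `rot_sector_injective`). [cite: Nolin2008, Prop. 14 (arXiv 0711.4948: Prop. 13)] [cite: SmirnovWernerMRL2001, §4.2 (p. 9, "by standard RSW theory")] -/
theorem exists_pow_le_landedAltFourArm_dyadic :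
    ∃ c₀ : ℝ, 0 < c₀ ∧ c₀ ≤ 1 / 2 ∧ ∀ n m : ℕ, 3 ≤ n →
      c₀ ^ ((2 * m + 1) * 4) ≤ (triSitePercolation half).real (landedAltFourArm n (2 ^ (m + 2) * n)) := by
  classical
  obtain ⟨c₀, hc₀, hrsw⟩ := tri_rsw_half_holds (9 : ℝ) (by norm_num)
  have key : ∀ w h : ℕ, 1 ≤ h → w ≤ 9 * h → c₀ ≤ triLRCrossingProb half w h := by
    intro w h hh hw
    have hfl : ⌊(9 : ℝ) * h⌋₊ = 9 * h := by
      have : (9 : ℝ) * h = ((9 * h : ℕ) : ℝ) := by push_cast; ring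
      rw [this, Nat.floor_natCast]
    obtain ⟨h1, -⟩ := hrsw h (by rw [hfl]; omega)
    rw [hfl] at h1
    exact h1.trans (triLRCrossingProb_anti_width half hw h)
  have hc₀le : c₀ ≤ 1 / 2 := by
    have hfl : ⌊(9 : ℝ) * ((1 : ℕ) : ℝ)⌋₊ = 9 := by norm_num
    obtain ⟨h1, h2⟩ := hrsw 1 (by rw [hfl]; norm_num)
    linarith
  refine ⟨c₀, hc₀, hc₀le, fun n m hn => ?_⟩
  have hn2 : 2 ≤ n := by omega
  -- the chain events and their supports
  set H : ℕ → Set (SiteConfig (Site 2)) := fun i =>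
    triHCross ((2 ^ i * n : ℕ) : ℤ) (1 - ((2 ^ i * n : ℕ) : ℤ)) (3 * (2 ^ i * n)) (2 ^ i * n - 2)
    with hH
  set FH : ℕ → Finset (Site 2) := fun i =>
    triStripFinset ((2 ^ i * n : ℕ) : ℤ) (1 - ((2 ^ i * n : ℕ) : ℤ)) (3 * (2 ^ i * n)) (2 ^ i * n - 2)
    with hFH
  set V : ℕ → Set (SiteConfig (Site 2)) := fun i =>
    triVCross ((2 ^ (i + 1) * n : ℕ) : ℤ) (1 - ((2 ^ (i + 1) * n : ℕ) : ℤ)) (2 ^ (i + 1) * n)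
      (2 ^ (i + 1) * n - 2) with hV
  set FV : ℕ → Finset (Site 2) := fun i =>
    triStripFinset ((2 ^ (i + 1) * n : ℕ) : ℤ) (1 - ((2 ^ (i + 1) * n : ℕ) : ℤ)) (2 ^ (i + 1) * n)
      (2 ^ (i + 1) * n - 2) with hFV
  set IH : Set (SiteConfig (Site 2)) := ⋂ i ∈ Finset.range (m + 1), H i with hIH
  set IV : Set (SiteConfig (Site 2)) := ⋂ i ∈ Finset.range m, V i with hIV
  set F : Finset (Site 2) := (Finset.range (m + 1)).biUnion FH ∪ (Finset.range m).biUnion FV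
    with hF
  have dH : DeterminedBy IH ↑((Finset.range (m + 1)).biUnion FH) :=
    DeterminedBy.biInter_finset _ fun i _ => determinedBy_triHCross _ _ _ _
  have dV : DeterminedBy IV ↑((Finset.range m).biUnion FV) :=
    DeterminedBy.biInter_finset _ fun i _ => determinedBy_triVCross _ _ _ _
  have dC : DeterminedBy (IH ∩ IV) ↑F := by
    rw [hF, Finset.coe_union]
    exact (dH.mono Set.subset_union_left).inter (dV.mono Set.subset_union_right)
  have uH : IsUpperSet IH := isUpperSet_iInter₂ fun i _ => isUpperSet_triHCross _ _ _ _
  have uV : IsUpperSet IV := isUpperSet_iInter₂ fun i _ => isUpperSet_triVCross _ _ _ _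
  have hscale : ∀ i : ℕ, 3 ≤ 2 ^ i * n := fun i =>
    le_trans hn (Nat.le_mul_of_pos_left n (Nat.two_pow_pos i))
  -- RSW and the Harris chain
  have pH : c₀ ^ (m + 1) ≤ (triSitePercolation half).real IH := by
    have h := sitePercolation_real_biInter_ge_prod half (Finset.range (m + 1)) (E := H) (F := FH)
      (fun i _ => determinedBy_triHCross _ _ _ _) (fun i _ => isUpperSet_triHCross _ _ _ _)
    refine le_trans ?_ h
    calc c₀ ^ (m + 1) = ∏ _i ∈ Finset.range (m + 1), c₀ := by simp
      _ ≤ ∏ i ∈ Finset.range (m + 1), (sitePercolation (Site 2) half).real (H i) := by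
          refine Finset.prod_le_prod (fun _ _ => hc₀.le) fun i _ => ?_
          have : (sitePercolation (Site 2) half).real (H i) =
              triLRCrossingProb half (3 * (2 ^ i * n)) (2 ^ i * n - 2) :=
            triSitePercolation_real_triHCross half _ _ _ _
          rw [this]
          have h3 := hscale i
          exact key _ _ (by omega) (by omega)
  have pV : c₀ ^ m ≤ (triSitePercolation half).real IV := by
    have h := sitePercolation_real_biInter_ge_prod half (Finset.range m) (E := V) (F := FV)
      (fun i _ => determinedBy_triVCross _ _ _ _) (fun i _ => isUpperSet_triVCross _ _ _ _)
    refine le_trans ?_ h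
    calc c₀ ^ m = ∏ _i ∈ Finset.range m, c₀ := by simp
      _ ≤ ∏ i ∈ Finset.range m, (sitePercolation (Site 2) half).real (V i) := by
          refine Finset.prod_le_prod (fun _ _ => hc₀.le) fun i _ => ?_
          have : (sitePercolation (Site 2) half).real (V i) =
              triLRCrossingProb half (2 ^ (i + 1) * n - 2) (2 ^ (i + 1) * n) :=
            triSitePercolation_real_triVCross half _ _ _ _
          rw [this]
          have h3 := hscale (i + 1)
          exact key _ _ (by omega) (by omega)
  have pC : c₀ ^ (2 * m + 1) ≤ (triSitePercolation half).real (IH ∩ IV) := by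
    have h := sitePercolation_harris' half dH dV uH uV
    calc c₀ ^ (2 * m + 1) = c₀ ^ (m + 1) * c₀ ^ m := by rw [← pow_add]; ring_nf
      _ ≤ (triSitePercolation half).real IH * (triSitePercolation half).real IV :=
          mul_le_mul pH pV (by positivity) measureReal_nonneg
      _ ≤ (triSitePercolation half).real (IH ∩ IV) := h
  -- the chain is an open arm inside the open cone
  have hCpath : ∀ ω ∈ IH ∩ IV, ∃ x y : Site 2, triNorm x = n ∧
      triNorm y = ((2 ^ (m + 2) * n : ℕ) : ℤ) ∧
      PathIn triGraph ({z : Site 2 | 0 < z 0 ∧ z 1 < 0 ∧ 0 < z 0 + z 1} ∩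
        triAnnSet n (2 ^ (m + 2) * n) ∩ ω) x y := by
    rintro ω ⟨h1, h2⟩
    rw [hIH] at h1
    rw [hIV] at h2
    simp only [Set.mem_iInter, Finset.mem_range] at h1 h2
    exact exists_sectorPath_of_sectorChain hn2 m (fun i hi => h1 i (Nat.lt_succ_of_le hi))
      (fun i hi => h2 i hi)
  -- the sites of `F` lie in the open cone
  have hcast : ∀ i : ℕ, ((2 ^ i * n - 2 : ℕ) : ℤ) = ((2 ^ i * n : ℕ) : ℤ) - 2 := fun i => by
    rw [Nat.cast_sub (le_trans hn2 (Nat.le_mul_of_pos_left n (Nat.two_pow_pos i)))]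
    rfl
  have hFsec : ∀ w ∈ F, 0 < w 0 ∧ w 1 < 0 ∧ 0 < w 0 + w 1 := by
    intro w hw
    rw [hF, Finset.mem_union, Finset.mem_biUnion, Finset.mem_biUnion] at hw
    rcases hw with ⟨i, -, hw⟩ | ⟨i, -, hw⟩
    · have hw' : w ∈ (↑(FH i) : Set (Site 2)) := hw
      simp only [hFH, coe_triStripFinset, mem_triStrip] at hw'
      rw [hcast i] at hw'
      have h3 : (3 : ℤ) ≤ ((2 ^ i * n : ℕ) : ℤ) := by exact_mod_cast hscale i
      push_cast at hw' h3
      exact ⟨by linarith, by linarith, by linarith⟩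
    · have hw' : w ∈ (↑(FV i) : Set (Site 2)) := hw
      simp only [hFV, coe_triStripFinset, mem_triStrip] at hw'
      rw [hcast (i + 1)] at hw'
      have h3 : (3 : ℤ) ≤ ((2 ^ (i + 1) * n : ℕ) : ℤ) := by exact_mod_cast hscale (i + 1)
      push_cast at hw' h3
      exact ⟨by linarith, by linarith, by linarith⟩
  -- the four rotated, recoloured copies of the chain event: frame `landSide j`, colour `κ j`
  set κ : Fin 4 → Bool := ![true, false, true, false] with hκ
  set sd : ℕ → ℕ := fun j => if h : j < 4 then landSide ⟨j, h⟩ else 0 with hsd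
  set cl : ℕ → Bool := fun j => if h : j < 4 then κ ⟨j, h⟩ else true with hcl
  set Y : ℕ → Set (SiteConfig (Site 2)) := fun j =>
    (fun ω : SiteConfig (Site 2) => {v : Site 2 | v ∈ ω ↔ cl j}) ⁻¹' (rotConfig (sd j) ⁻¹' (IH ∩ IV))
    with hY
  set FY : ℕ → Finset (Site 2) := fun j => F.image (triRotIsoPow (sd j)) with hFY
  have dY : ∀ j, DeterminedBy (Y j) ↑(FY j) := fun j => by
    show DeterminedBy ((fun ω : SiteConfig (Site 2) => {v : Site 2 | v ∈ ω ↔ cl j}) ⁻¹'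
      (rotConfig (sd j) ⁻¹' (IH ∩ IV))) ↑(F.image (triRotIsoPow (sd j)))
    rw [Finset.coe_image]
    exact determinedBy_preimage_colour (cl j) (determinedBy_preimage_rotConfig (sd j) dC)
  have pY : ∀ j, (triSitePercolation half).real (Y j) =
      (triSitePercolation half).real (IH ∩ IV) := fun j => by
    show (triSitePercolation half).real ((fun ω : SiteConfig (Site 2) =>
      {v : Site 2 | v ∈ ω ↔ cl j}) ⁻¹' (rotConfig (sd j) ⁻¹' (IH ∩ IV))) = _
    rw [triSitePercolation_half_real_preimage_colour, real_preimage_rotConfig]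
  have hsd_lt : ∀ j, sd j < 6 := fun j => by
    simp only [hsd]
    split_ifs with h
    · exact landSide_lt_six _
    · norm_num
  have hsd_inj : ∀ i j, i < 4 → j < 4 → sd i = sd j → i = j := by
    intro i j hi hj h
    simp only [hsd, hi, hj, dite_true] at h
    have := landSide_injective h
    simpa using this
  have hdisj : ∀ i j, i < j → j < 4 → Disjoint (FY i) (FY j) := by
    intro i j hij hj4
    rw [Finset.disjoint_left]
    intro v hvi hvj
    simp only [hFY, Finset.mem_image] at hvi hvj
    obtain ⟨w, hw, rfl⟩ := hvi
    obtain ⟨w', hw', he⟩ := hvj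
    have h1 := rot_sector_injective (hsd_lt i) (hsd_lt j) (hFsec w hw) (hFsec w' hw') he.symm
    have := hsd_inj i j (by omega) hj4 h1
    omega
  -- independence
  have hind : (triSitePercolation half).real (⋂ j < 4, Y j) =
      ∏ j ∈ Finset.range 4, (triSitePercolation half).real (Y j) :=
    sitePercolation_real_iInter_eq_prod half (fun j _ => dY j) hdisj
  -- the intersection is contained in the landed alternating event
  set N : ℕ := 2 ^ (m + 2) * n with hNdef
  have hsub : (⋂ j < 4, Y j) ⊆ landedAltFourArm n N := by
    intro ω hω
    simp only [Set.mem_iInter] at hω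
    -- the four coloured site sets
    set T : Fin 4 → Set (Site 2) := fun j =>
      (triRotIsoPow (landSide j) '' {z : Site 2 | 0 < z 0 ∧ z 1 < 0 ∧ 0 < z 0 + z 1}) ∩
        triAnnSet n N ∩ {v | v ∈ ω ↔ κ j} with hT
    have hsdj : ∀ j : Fin 4, sd j = landSide j := fun j => by simp [hsd, j.2]
    have hclj : ∀ j : Fin 4, cl j = κ j := fun j => by simp [hcl, j.2]
    refine mem_landedAltFourArm_of_pathIn T ?_ ?_ ?_ ?_
    · -- pairwise disjoint: distinct cones
      intro i j hij
      rw [Set.disjoint_left]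
      rintro v ⟨⟨⟨u, hu, rfl⟩, -⟩, -⟩ ⟨⟨⟨u', hu', he⟩, -⟩, -⟩
      have h1 := rot_sector_injective (landSide_lt_six i) (landSide_lt_six j) hu hu' he.symm
      exact hij (landSide_injective h1)
    · -- colours
      intro i z hz
      have h := hz.2
      simp only [Set.mem_setOf_eq] at h
      rw [h]
    · -- inside the annulus
      intro i z hz
      exact (mem_triAnnSet.1 hz.1.2)
    · -- the paths
      intro j
      have hj : rotConfig (sd j) {v : Site 2 | v ∈ ω ↔ cl j} ∈ IH ∩ IV := hω j j.2
      rw [hsdj j, hclj j] at hj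
      obtain ⟨x, y, hx, hy, hp⟩ := hCpath _ hj
      have hq := pathIn_of_rotConfig_colour (landSide j) (κ j) hp
      have hycone : 0 < y 0 ∧ y 1 < 0 ∧ 0 < y 0 + y 1 := hp.right_mem.1.1
      refine ⟨triRotIsoPow (landSide j) x, ?_, triRotIsoPow (landSide j) y, ?_, hq.mono ?_⟩
      · rw [mem_triSphere_iff, triNorm_rot, hx]
      · exact rot_mem_hexSide_of_cone hycone (by rw [hy])
      · rintro v ⟨⟨u, ⟨hu1, hu2⟩, rfl⟩, hv⟩
        refine ⟨⟨⟨u, hu1, rfl⟩, ?_⟩, hv⟩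
        rw [mem_triAnnSet] at hu2 ⊢
        rw [triNorm_rot]
        exact hu2
  -- conclusion
  calc c₀ ^ ((2 * m + 1) * 4) = (c₀ ^ (2 * m + 1)) ^ 4 := pow_mul _ _ _
    _ ≤ ((triSitePercolation half).real (IH ∩ IV)) ^ 4 := pow_le_pow_left₀ (by positivity) pC 4
    _ = ∏ j ∈ Finset.range 4, (triSitePercolation half).real (Y j) := by
        rw [Finset.prod_congr rfl fun j _ => pY j, Finset.prod_const, Finset.card_range]
    _ = (triSitePercolation half).real (⋂ j < 4, Y j) := hind.symm
    _ ≤ (triSitePercolation half).real (landedAltFourArm n N) :=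
        measureReal_mono hsub (measure_ne_top _ _)

/-- **A-priori RSW lower bound for the alternating four-arm probability**: there are `c, ζ > 0`
with `c (n/N)^ζ ≤ P_{1/2}(altFourArm n N)` for all `3 ≤ n ≤ N` (Nolin 2008, Prop. 14 [arXiv
0711.4948: Prop. 13], lower half, `j = 4`, `σ = BWBW`, `p = 1/2`; Smirnov–Werner 2001, §4.2 p. 9;
Werner 2009, Lecture 6, §3, third a-priori estimate, in the weak form "some power"). From
`exists_pow_le_landedAltFourArm_dyadic` at `m = ⌊log₂ (N/n)⌋`, `landedAltFourArm ⊆ altFourArm`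
and the anti-monotonicity of `altFourArm` in the outer radius. [cite: Nolin2008, Prop. 14 (arXiv 0711.4948: Prop. 13)] [cite: SmirnovWernerMRL2001, §4.2 (p. 9, "by standard RSW theory")] -/
theorem exists_rpow_le_altFourArmProb :
    ∃ c ζ : ℝ, 0 < c ∧ 0 < ζ ∧ ∀ n N : ℕ, 3 ≤ n → n ≤ N →
      c * ((n : ℝ) / N) ^ ζ ≤ altFourArmProbAt half n N := by
  obtain ⟨c₀, hc₀, hc₀le, h⟩ := exists_pow_le_landedAltFourArm_dyadic
  have hc₀1 : c₀ < 1 := by linarith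
  set ζ₁ : ℝ := -Real.log c₀ / Real.log 2 with hζ₁
  have hζ₁pos : 0 < ζ₁ :=
    div_pos (neg_pos.2 (Real.log_neg hc₀ hc₀1)) (Real.log_pos one_lt_two)
  refine ⟨c₀ ^ 4, 8 * ζ₁, by positivity, by positivity, fun n N hn hnN => ?_⟩
  have hn1 : 1 ≤ n := by omega
  obtain ⟨hreal, hN2⟩ := dyadicIndex_spec hn1 hnN
  set m : ℕ := Nat.log 2 (N / n) with hm
  have hmono : altFourArmProbAt half n (2 ^ (m + 2) * n) ≤ altFourArmProbAt half n N :=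
    altFourArmProbAt_anti half n hnN hN2
  have hland : (triSitePercolation half).real (landedAltFourArm n (2 ^ (m + 2) * n)) ≤
      altFourArmProbAt half n (2 ^ (m + 2) * n) :=
    measureReal_mono (landedAltFourArm_subset_altFourArm hn1
      (Nat.le_mul_of_pos_left n (Nat.two_pow_pos _))) (measure_ne_top _ _)
  refine le_trans ?_ (((h n m hn).trans hland).trans hmono)
  -- `c₀^4 (n/N)^{8ζ₁} ≤ c₀^{4(2m+1)}`: `(n/N)^{ζ₁} ≤ c₀^m`
  have hpow := rpow_ratio_le_pow hc₀ hc₀1 hn1 hnN hreal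
  have hx0 : 0 ≤ (n : ℝ) / N := by positivity
  have hx : 0 ≤ ((n : ℝ) / N) ^ ζ₁ := Real.rpow_nonneg hx0 _
  calc c₀ ^ 4 * ((n : ℝ) / N) ^ (8 * ζ₁) = c₀ ^ 4 * (((n : ℝ) / N) ^ ζ₁) ^ 8 := by
        rw [mul_comm (8 : ℝ) ζ₁, Real.rpow_mul hx0]; norm_cast
    _ ≤ c₀ ^ 4 * (c₀ ^ m) ^ 8 := by gcongr
    _ = c₀ ^ ((2 * m + 1) * 4) := by rw [← pow_mul, ← pow_add]; ring_nf

/-! ### Scale bounds for the alternating event from (16)₄ and (9)₄ -/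

/-- **(16)₄ + (9)₄ ⇒ two-sided scale bounds for the alternating probabilities**: IF
`P_{1/2}(altFourArm (ρ r) (ρ R)) → g(R/r)` for all integers `1 ≤ r < R` (GPS 2013 Lemma 2.9 /
Smirnov–Werner (16)) and `log g(n) / log n → -5/4` along the integers (SW (9), `j = 4`), THEN for
every `ε > 0`, for all large `K` and then all large `σ`,
`K^{-5/4-ε} ≤ P_{1/2}(altFourArm (4σ) (Kσ)) ≤ K^{-5/4+ε}`. The alternating probabilities are
non-increasing in the outer radius (`altFourArmProbAt_anti`), at most `1`, and obey the RSW lower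
bound `exists_rpow_le_altFourArmProb`, so the abstract calculus of
`PolyArmScalingLimit.tendsto_log_limit_div_log` (the exponent at inner radius `4`) and
`ArmExponentAssembly.scaleBounds_of_natLimit` applies. [cite: SmirnovWernerMRL2001, §4 (9), (16)] [cite: GarbanPeteSchramm2013Pivotal, §2.4 Lemma 2.9] -/
theorem altFourArmProb_scaleBounds_of_limits (g : ℝ → ℝ)
    (hlim : ∀ r R : ℕ, 1 ≤ r → r < R →
      Tendsto (fun ρ : ℕ => altFourArmProbAt half (ρ * r) (ρ * R)) atTop (𝓝 (g ((R : ℝ) / r))))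
    (hexp : Tendsto (fun n : ℕ => Real.log (g n) / Real.log n) atTop (𝓝 (-(5 / 4)))) :
    ∀ ε : ℝ, 0 < ε → ∀ᶠ K : ℕ in atTop, ∀ᶠ σ : ℕ in atTop,
      (K : ℝ) ^ (-(5 / 4 : ℝ) - ε) ≤ altFourArmProbAt half (σ * 4) (σ * K) ∧
        altFourArmProbAt half (σ * 4) (σ * K) ≤ (K : ℝ) ^ (-(5 / 4 : ℝ) + ε) := by
  obtain ⟨c, ζ, hc, -, hlow⟩ := exists_rpow_le_altFourArmProb
  set L : ℕ → ℕ → ℝ := fun r R => g ((R : ℝ) / r) with hL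
  have hlim' : ∀ r R : ℕ, 1 ≤ r → r < R →
      Tendsto (fun ρ : ℕ => altFourArmProbAt half (ρ * r) (ρ * R)) atTop (𝓝 (L r R)) := hlim
  have hanti : ∀ ⦃r R R' : ℕ⦄, r ≤ R → R ≤ R' → altFourArmProbAt half r R' ≤ altFourArmProbAt half r R :=
    fun r R R' hr hR => altFourArmProbAt_anti half r hr hR
  have hexp' : Tendsto (fun n : ℕ => Real.log (L 1 n) / Real.log n) atTop (𝓝 (-(5 / 4))) := by
    have hL1 : ∀ n : ℕ, L 1 n = g n := fun n => by simp [hL]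
    simp only [hL1]
    exact hexp
  have h4 : Tendsto (fun K : ℕ => Real.log (L 4 K) / Real.log K) atTop (𝓝 (-(5 / 4))) :=
    PolyArmScalingLimit.tendsto_log_limit_div_log hlim' hanti (fun r R => altFourArmProbAt_le_one half r R)
      hc hlow hexp' (by norm_num)
  exact ArmExponentAssembly.scaleBounds_of_natLimit (fun r R => altFourArmProbAt half r R)
    (fun r R => altFourArmProbAt_nonneg half r R) (fun K => L 4 K) (fun K hK => hlim' 4 K (by norm_num) hK)
    (by norm_num) h4

/-- **Scale bounds pass from the alternating event to `π₄` through the bridge**: IF the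
alternating probabilities obey the two-sided scale bounds with exponent `5/4` and
`c · π₄(n, N) ≤ P_{1/2}(altFourArm n N)` for `n₀ ≤ n`, `2n ≤ N` (colour switching; with
`P(altFourArm) ≤ π₄`, `altFourArmProbAt_le_fourArmProbAt`), THEN `π₄` obeys the same scale bounds
(the constant `1/c` is absorbed by `K^{ε}`; Smirnov–Werner 2001, before Thm. 4: prescribing the
order "will change `b_j` up to a multiplicative constant"). [cite: SmirnovWernerMRL2001, §4 (paragraph before Thm. 4) and (9), (16)] -/
theorem critFourArmProb_scaleBounds_of_alt
    (hA : ∀ ε : ℝ, 0 < ε → ∀ᶠ K : ℕ in atTop, ∀ᶠ σ : ℕ in atTop,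
      (K : ℝ) ^ (-(5 / 4 : ℝ) - ε) ≤ altFourArmProbAt half (σ * 4) (σ * K) ∧
        altFourArmProbAt half (σ * 4) (σ * K) ≤ (K : ℝ) ^ (-(5 / 4 : ℝ) + ε))
    (hBr : ∃ c : ℝ, 0 < c ∧ ∃ n₀ : ℕ, ∀ n N : ℕ, n₀ ≤ n → 2 * n ≤ N →
      c * critFourArmProb n N ≤ (triSitePercolation half).real (altFourArm n N)) :
    ∀ ε : ℝ, 0 < ε → ∀ᶠ K : ℕ in atTop, ∀ᶠ σ : ℕ in atTop,
      (K : ℝ) ^ (-(5 / 4 : ℝ) - ε) ≤ critFourArmProb (σ * 4) (σ * K) ∧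
        critFourArmProb (σ * 4) (σ * K) ≤ (K : ℝ) ^ (-(5 / 4 : ℝ) + ε) := by
  obtain ⟨c, hc, n₀, hbr⟩ := hBr
  intro ε hε
  have hε2 : 0 < ε / 2 := by linarith
  -- `K^{ε/2} ≥ 1/c` eventually
  have hKε : Tendsto (fun K : ℕ => (K : ℝ) ^ (ε / 2)) atTop atTop :=
    (tendsto_rpow_atTop hε2).comp tendsto_natCast_atTop_atTop
  filter_upwards [hA (ε / 2) hε2, hKε.eventually_ge_atTop c⁻¹, eventually_ge_atTop 8] with K hK hKc hK8
  have hK1 : (1 : ℝ) ≤ K := by exact_mod_cast (le_trans (by norm_num) hK8)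
  have hKpos : (0 : ℝ) < K := by linarith
  filter_upwards [hK, eventually_ge_atTop n₀] with σ hσ hσn
  have hn₀ : n₀ ≤ σ * 4 := le_trans hσn (Nat.le_mul_of_pos_right σ (by norm_num))
  have h2 : 2 * (σ * 4) ≤ σ * K := by
    rw [mul_comm 2, mul_assoc]; exact Nat.mul_le_mul_left σ (by omega)
  have hb := hbr (σ * 4) (σ * K) hn₀ h2
  rw [← altFourArmProbAt_half] at hb
  have hup : altFourArmProbAt half (σ * 4) (σ * K) ≤ critFourArmProb (σ * 4) (σ * K) := by
    have := altFourArmProbAt_le_fourArmProbAt half (σ * 4) (σ * K)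
    rwa [fourArmProbAt_half] at this
  constructor
  · calc (K : ℝ) ^ (-(5 / 4 : ℝ) - ε) ≤ (K : ℝ) ^ (-(5 / 4 : ℝ) - ε / 2) :=
          Real.rpow_le_rpow_of_exponent_le hK1 (by linarith)
      _ ≤ altFourArmProbAt half (σ * 4) (σ * K) := hσ.1
      _ ≤ critFourArmProb (σ * 4) (σ * K) := hup
  · -- `π₄ ≤ a / c ≤ K^{ε/2} · K^{-5/4+ε/2} = K^{-5/4+ε}`
    have h1 : critFourArmProb (σ * 4) (σ * K) ≤ c⁻¹ * altFourArmProbAt half (σ * 4) (σ * K) := by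
      rw [← div_eq_inv_mul, le_div_iff₀ hc, mul_comm]; exact hb
    calc critFourArmProb (σ * 4) (σ * K) ≤ c⁻¹ * altFourArmProbAt half (σ * 4) (σ * K) := h1
      _ ≤ (K : ℝ) ^ (ε / 2) * (K : ℝ) ^ (-(5 / 4 : ℝ) + ε / 2) :=
          mul_le_mul hKc hσ.2 (altFourArmProbAt_nonneg _ _ _) (Real.rpow_nonneg hKpos.le _)
      _ = (K : ℝ) ^ (-(5 / 4 : ℝ) + ε) := by
          rw [← Real.rpow_add hKpos]; ring_nf

/-! ### The four-arm exponent from (16)₄, (9)₄, Sep and Land -/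

/-- **The four-arm exponent from its four published inputs** (Smirnov–Werner 2001, Thm. 4 for
`j = 4`, by the printed route: scaling limit (16) and `SLE₆` exponent (9) for the alternating
event, quasi-multiplicativity (10) from Kesten's arm separation, and "prescribing the order changes
`b_j` up to a multiplicative constant" by Nolin's colour exchange). IF
(16)₄ `P_{1/2}(altFourArm (ρr) (ρR)) → g(R/r)` (`1 ≤ r < R`; GPS 2013 Lemma 2.9),
(9)₄ `log g(n) / log n → -5/4` (SW (9) with (12)–(15); LSW 2001),
Sep `c · P_{1/2}(altFourArm n N) ≤ P_{1/2}(sepFourArm n N)` (`n₀ ≤ n`, `2n ≤ N`; Nolin Thm. 11,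
`j = 4`, `σ = BWBW`) and
Land `c · P_{1/2}(adjFourArm n N) ≤ P_{1/2}(landedFourAdj n N)` (Nolin Thm. 11, `j = 4`,
`σ = BBWW`, external landing), THEN `fourArm_exponent`. Everything else — the bridge
(`fourArm_bridge_of_landing`, with the flip `fourArm_flip` proved), separation and
quasi-multiplicativity for `π₄` (`critFourArm_separation_of_alt`,
`critFourArmProb_quasiMult_of_separation`), the RSW bounds and the assembly along the scales
(`fourArm_exponent_of_scaleBounds_crit`) — is proved in the tree. [cite: SmirnovWernerMRL2001, Thm. 4 (j = 4), §4 (9), (10), (16) and the paragraph before Thm. 4] [cite: GarbanPeteSchramm2013Pivotal, §2.4 Lemma 2.9] [cite: Nolin2008, Thm. 11 and Prop. 20 (arXiv 0711.4948: Thm. 10, Prop. 19)] -/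
theorem fourArm_exponent_of_altLimits (g : ℝ → ℝ)
    (hlim : ∀ r R : ℕ, 1 ≤ r → r < R →
      Tendsto (fun ρ : ℕ => altFourArmProbAt half (ρ * r) (ρ * R)) atTop (𝓝 (g ((R : ℝ) / r))))
    (hexp : Tendsto (fun n : ℕ => Real.log (g n) / Real.log n) atTop (𝓝 (-(5 / 4))))
    (hAlt : ∃ c : ℝ, 0 < c ∧ ∃ n₀ : ℕ, ∀ n N : ℕ, n₀ ≤ n → 2 * n ≤ N →
      c * (triSitePercolation half).real (altFourArm n N) ≤
        (triSitePercolation half).real (sepFourArm n N))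
    (hLand : ∃ c : ℝ, 0 < c ∧ ∃ n₀ : ℕ, ∀ n N : ℕ, n₀ ≤ n → 2 * n ≤ N →
      c * (triSitePercolation half).real (adjFourArm n N) ≤
        (triSitePercolation half).real (landedFourAdj n N)) :
    fourArm_exponent := by
  have hBr := fourArm_bridge_of_landing hLand
  exact fourArm_exponent_of_scaleBounds_crit
    (critFourArmProb_scaleBounds_of_alt (altFourArmProb_scaleBounds_of_limits g hlim hexp) hBr)
    (critFourArmProb_quasiMult_of_separation (critFourArm_separation_of_alt hAlt hBr))

/-- **The same with the near-critical alternating separation hypothesis** of the `θ`-exponent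
programme (`PivotalLowerBoundFromSeparation.lean`, in the alternating form of `ArmPatternsFourArm`
/ `PivotalLowerBoundAlt`), read at `t = 1/2` (`critAltFourArm_separation_of_nearCritical`): one
separation theorem (Nolin Thm. 11 for `σ = BWBW`, uniform below `L(p)`) serves both programmes.
[cite: SmirnovWernerMRL2001, Thm. 4 (j = 4)] [cite: Nolin2008, Thm. 11 (arXiv 0711.4948: Thm. 10)] -/
theorem fourArm_exponent_of_altLimits_of_nearCritical (g : ℝ → ℝ)
    (hlim : ∀ r R : ℕ, 1 ≤ r → r < R →
      Tendsto (fun ρ : ℕ => altFourArmProbAt half (ρ * r) (ρ * R)) atTop (𝓝 (g ((R : ℝ) / r))))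
    (hexp : Tendsto (fun n : ℕ => Real.log (g n) / Real.log n) atTop (𝓝 (-(5 / 4))))
    (hsep : ∃ ε₁ > (0 : ℝ), ∀ ⦃ε : ℝ⦄, 0 < ε → ε < ε₁ →
      ∃ n₀ : ℕ, ∃ δ > (0 : ℝ), ∃ c > (0 : ℝ),
        ∀ t : unitInterval, 1 / 2 ≤ (t : ℝ) → (t : ℝ) < 1 / 2 + δ →
          ∀ n N : ℕ, n₀ ≤ n → 2 * n ≤ N → (1 / 2 < (t : ℝ) → N ≤ charLengthW ε t) →
            c * altFourArmProbAt t n N ≤ (triSitePercolation t).real (sepFourArm n N))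
    (hLand : ∃ c : ℝ, 0 < c ∧ ∃ n₀ : ℕ, ∀ n N : ℕ, n₀ ≤ n → 2 * n ≤ N →
      c * (triSitePercolation half).real (adjFourArm n N) ≤
        (triSitePercolation half).real (landedFourAdj n N)) :
    fourArm_exponent :=
  fourArm_exponent_of_altLimits g hlim hexp (critAltFourArm_separation_of_nearCritical hsep) hLand

end Literature.Probability.Percolation

end
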